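import Literature.MathematicalPhysics.QuantumLattice.HubbardPolymerRepresentation
import Literature.MathematicalPhysics.QuantumLattice.TraceInequalitiesProofs
import HarnessLib

/-!
# Bounds on the Hubbard polymer weights: smallness per bond, Kotecký–Preiss smallness

Ueltschi (1999), proof of Theorem 2.1 (i), the estimates: "We have now to bound `ρ(𝒜)` …
`‖e^{-βV_x}‖ = e^{-βe₀} ≤ e^{-βf₀}` … we obtain `|ρ(𝒜)| ≤ e^{-(c - log S - 1)‖𝒜‖}`", and §3:
"our polymers are now connected sets" with the connected-set entropy `ℶ`. For the
inclusion–exclusion weights of `HubbardPolymerRepresentation` (bond weights `M(K)`, site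
activity `siteActivity A = Σ_{X connected, supp X = A} M(X)`) we PROVE:

* `norm_trace_exp_le`: for any matrix `T`,
  `|Tr exp(-βV_A + T)| ≤ e^{‖T‖} · z₀ʳ^{|A|} 4^{|Λ|-|A|}` with the REAL one-site partition
  function `z₀ʳ = 1 + 2e^{Re βμ} + e^{-(Re βU - 2Re βμ)}` of the Hermitian part of `βV`
  (Petz/Bernstein–Golden–Thompson chain of the tree, `norm_trace_mul_exp_le_of_hermitianPart_le`;
  this is Ueltschi's `‖e^{-βV_x}‖ ≤ e^{-βf₀}` step, valid for complex `β, μ` through the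
  **site ratio** `r = z₀ʳ/|z₀|`, `siteRatio`, which is `1` at real parameters, `siteRatio_ofReal`);
* `norm_gibbsRatio_le`: `|g(c)| ≤ e^{‖Σ c_b T_b‖} r^{|A|}` for couplings supported inside `A`
  (two-fold factorisation `Zc(c) · 2^{|Orb Λ|} = Tr e^{-βV_A + Σ c T} · Tr e^{-βV_{Aᶜ}}`);
* `norm_bondWeight_le`: `|M(K)| ≤ (e²|τ|)^{|K|} r^{|supp K|}` for `|τ| ≤ 1` (Cauchy bound for
  iterated differences, `IteratedDifferenceBound.norm_iterDiff_zero_le`, radius `1`);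
* `sum_norm_siteActivity_mul_exp_le`: on a graph of maximal degree `Δ`, for every site `x` and
  every finite family `𝒜` of distinct site sets containing `x`,
  `Σ_{A ∈ 𝒜} |siteActivity A| e^{2|A|} ≤ 8Δ λ`, `λ = e⁶ r₀² |τ|`, as soon as `r ≤ r₀` (`r₀ ≥ 1`),
  `|τ| ≤ 1` and `(8Δ+1)² λ ≤ 1/2` (lattice-animal count of connected bond sets through a bond,
  `sum_pow_card_le_of_connected`). With `8Δλ ≤ 1` this is the one-site Kotecký–Preiss
  smallness with `δ = 1` (`IsSmallTIActivity.sum_le_one`), i.e. Ueltschi's condition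
  "`2χ e^{c+1} βt ≤ 1`" in our constants.

## Mathlib / tree search

Tree: `norm_trace_mul_exp_le_of_hermitianPart_le`, `petz_norm_trace_exp_add_le_holds`
(`TraceInequalitiesProofs`), `norm_creation_le_one`, `norm_annihilation_le_one`
(`HubbardGaugeBound`), `trace_exp_neg_onSiteSum`, `trace_mul_of_mem_carSubalgebra`,
`norm_iterDiff_zero_le`, `sum_pow_card_le_of_connected` (`PolymerGasGeometric`),
`sum_biUnion_le_sum_of_nonneg` (`ClusterExpansionKPBound`). Mathlib: `NormedSpace.exp_analytic`,
`Matrix.l2_opNorm_conjTranspose`, `Matrix.isHermitian_diagonal_iff`.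

## References

* D. Ueltschi, J. Stat. Phys. 95 (1999) 693, §2.3 (bound on `ρ(𝒜)`), §3 (`|ρ(𝒜)| ≤ e^{-c|𝒜|}`
  when `2χ e^{c+1} βt ≤ 1`). [Ueltschi1999]
* D. Petz, Banach Center Publ. 30 (1994) 287, Theorem 5. [Petz1994]
-/

noncomputable section

namespace Literature.MathematicalPhysics.QuantumLattice

open Matrix Finset HubbardWave0 Literature.Analysis.Complex.FiniteDifference Literature.Probability.LatticeModels
open scoped BigOperators Matrix.Norms.L2Operator ComplexConjugate

variable {Λ : Type*} [LinearOrder Λ] [Fintype Λ]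

/-! ### Norms of the hopping operators -/

/-- `‖T_b‖ ≤ 1`. [folklore] -/
theorem norm_bondOp_le_one (b : Bond Λ) : ‖bondOp b‖ ≤ 1 := by
  rw [bondOp]
  calc ‖creation (orb b.1 b.2.2) * annihilation (orb b.2.1 b.2.2)‖
      ≤ ‖creation (orb b.1 b.2.2)‖ * ‖annihilation (orb b.2.1 b.2.2)‖ := l2_opNorm_mul _ _
    _ ≤ 1 * 1 := mul_le_mul (norm_creation_le_one _) (norm_annihilation_le_one _) (norm_nonneg _) zero_le_one
    _ = 1 := one_mul 1

/-- `‖Σ_b c_b T_b‖ ≤ Σ_b |c_b|`. [folklore] -/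
theorem norm_hopSum_le (c : Bond Λ → ℂ) : ‖hopSum c‖ ≤ ∑ b, ‖c b‖ := by
  rw [hopSum]
  refine (norm_sum_le _ _).trans (Finset.sum_le_sum fun b _ => ?_)
  rw [norm_smul]
  exact mul_le_of_le_one_right (norm_nonneg _) (norm_bondOp_le_one b)

/-- For couplings supported in `K` and bounded by `s`: `‖Σ_b c_b T_b‖ ≤ s |K|`. [folklore] -/
theorem norm_hopSum_le_mul_card {c : Bond Λ → ℂ} {K : Finset (Bond Λ)} {s : ℝ} (hs : ∀ b, ‖c b‖ ≤ s)
    (hK : ∀ b ∉ K, c b = 0) : ‖hopSum c‖ ≤ s * K.card := by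
  refine (norm_hopSum_le c).trans ?_
  rw [← Finset.sum_subset (Finset.subset_univ K) (fun b _ hb => by rw [hK b hb, norm_zero])]
  calc ∑ b ∈ K, ‖c b‖ ≤ ∑ _b ∈ K, s := Finset.sum_le_sum fun b _ => hs b
    _ = s * K.card := by rw [Finset.sum_const, nsmul_eq_mul, mul_comm]

/-! ### The eigenvalues of `βV_A` and their real parts -/

/-- The eigenvalue of `V_A(a, b) = Σ_{x∈A} (a n_{x↑}n_{x↓} - b(n_{x↑}+n_{x↓}))` on `|s⟩`. [folklore] -/
def onSiteDiag (a b : ℂ) (A : Finset Λ) (s : Finset (Orb Λ)) : ℂ := ∑ x ∈ A, onSiteEnergyAt a b x s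

/-- `β V_A(U, μ) = diagonal (onSiteDiag (βU) (βμ) A)`. [folklore] -/
theorem smul_onSiteSum_eq_diagonal (β U μ : ℂ) (A : Finset Λ) :
    β • onSiteSum U μ A = diagonal (onSiteDiag (β * U) (β * μ) A) := by
  rw [onSiteSum_eq_diagonal, ← diagonal_smul]
  congr 1
  funext s
  simp only [Pi.smul_apply, smul_eq_mul, onSiteDiag, Finset.mul_sum]
  refine Finset.sum_congr rfl fun x _ => ?_
  simp only [onSiteEnergyAt]
  ring

omit [Fintype Λ] in
/-- The one-site energy with complex coefficients `a, b`: real part and conjugate act on the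
coefficients. [folklore] -/
theorem onSiteEnergyAt_re_conj (a b : ℂ) (x : Λ) (s : Finset (Orb Λ)) :
    (((onSiteEnergyAt a b x s).re : ℝ) : ℂ) = onSiteEnergyAt (a.re : ℂ) (b.re : ℂ) x s ∧
      conj (onSiteEnergyAt a b x s) = onSiteEnergyAt (conj a) (conj b) x s := by
  unfold onSiteEnergyAt
  by_cases h0 : orb x 0 ∈ s <;> by_cases h1 : orb x 1 ∈ s <;> simp [h0, h1]

omit [Fintype Λ] in
/-- Real part of the eigenvalues. [folklore] -/
theorem onSiteDiag_re (a b : ℂ) (A : Finset Λ) (s : Finset (Orb Λ)) :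
    (((onSiteDiag a b A s).re : ℝ) : ℂ) = onSiteDiag (a.re : ℂ) (b.re : ℂ) A s := by
  unfold onSiteDiag
  rw [Complex.re_sum, Complex.ofReal_sum]
  exact Finset.sum_congr rfl fun x _ => (onSiteEnergyAt_re_conj a b x s).1

omit [Fintype Λ] in
/-- Conjugate of the eigenvalues. [folklore] -/
theorem conj_onSiteDiag (a b : ℂ) (A : Finset Λ) (s : Finset (Orb Λ)) :
    conj (onSiteDiag a b A s) = onSiteDiag (conj a) (conj b) A s := by
  unfold onSiteDiag
  rw [map_sum]
  exact Finset.sum_congr rfl fun x _ => (onSiteEnergyAt_re_conj a b x s).2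

/-! ### The trace bound -/

/-- **`|Tr exp(-βV_A + T)| ≤ e^{‖T‖} Tr exp(-Re(βV_A))`**, and the right-hand trace evaluated:
`Tr exp(-Re(βV_A)) = z₀ʳ^{|A|} 4^{|Λ|-|A|}` with `z₀ʳ = z₀(1, Re βU, Re βμ)` (the Hermitian part
of `βV_A` is the on-site operator with the real parts of the coefficients; the anti-Hermitian
part and `T` are handled by the tree's Petz/Bernstein–Golden–Thompson chain).
[cite: Ueltschi1999, §2.3 (‖e^{-βV_x}‖ = e^{-βe₀} ≤ e^{-βf₀}); Petz1994, Theorem 5] -/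
theorem norm_trace_exp_le (β U μ : ℂ) (A : Finset Λ) (T : Matrix (Finset (Orb Λ)) (Finset (Orb Λ)) ℂ) :
    ‖(NormedSpace.exp (-(β • onSiteSum U μ A) + T)).trace‖ ≤
      Real.exp ‖T‖ * (atomicPartitionFnReal 1 (β * U).re (β * μ).re ^ A.card * 4 ^ (Fintype.card Λ - A.card)) := by
  set d : Finset (Orb Λ) → ℂ := onSiteDiag (β * U) (β * μ) A with hd
  set H : Matrix (Finset (Orb Λ)) (Finset (Orb Λ)) ℂ := diagonal fun s => (((d s).re : ℝ) : ℂ) with hH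
  set D : Matrix (Finset (Orb Λ)) (Finset (Orb Λ)) ℂ := diagonal d - H - T with hD
  -- `H` is Hermitian and is the on-site operator with the real parts of the coefficients
  have hHh : H.IsHermitian := by
    rw [hH, Matrix.isHermitian_diagonal_iff]
    intro s
    rw [IsSelfAdjoint, Complex.star_def, Complex.conj_ofReal]
  have hHeq : H = onSiteSum ((β * U).re : ℂ) ((β * μ).re : ℂ) A := by
    rw [← one_smul ℂ (onSiteSum ((β * U).re : ℂ) ((β * μ).re : ℂ) A), smul_onSiteSum_eq_diagonal, one_mul, one_mul, hH]
    congr 1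
    funext s
    exact onSiteDiag_re _ _ _ _
  -- the exponent
  have hexp : -(β • onSiteSum U μ A) + T = -(1 : ℂ) • (H + D) := by
    rw [smul_onSiteSum_eq_diagonal, ← hd, hD, neg_one_smul]
    abel
  -- the Hermitian part of `D` is `-(T + Tᴴ)/2`
  have hDD : D + Dᴴ = -(T + Tᴴ) := by
    have hdiag : (diagonal d - H) + (diagonal d - H)ᴴ = 0 := by
      ext i j
      simp only [hH, Matrix.add_apply, Matrix.sub_apply, conjTranspose_apply, diagonal_apply, Matrix.zero_apply]
      by_cases hij : i = j
      · subst hij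
        simp only [if_true, star_sub, Complex.star_def, Complex.conj_ofReal]
        have h := Complex.add_conj (d i)
        linear_combination (norm := (push_cast; ring)) h
      · simp [hij, Ne.symm hij]
    rw [hD, show diagonal d - H - T = (diagonal d - H) - T by rfl, conjTranspose_sub,
      show diagonal d - H - T + ((diagonal d - H)ᴴ - Tᴴ) = ((diagonal d - H) + (diagonal d - H)ᴴ) - (T + Tᴴ) by abel,
      hdiag, zero_sub]
  have hDn : ‖(2 : ℂ)⁻¹ • (D + Dᴴ)‖ ≤ ‖T‖ := by
    rw [hDD, smul_neg, norm_neg, norm_smul, norm_inv, Complex.norm_two]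
    calc 2⁻¹ * ‖T + Tᴴ‖ ≤ 2⁻¹ * (‖T‖ + ‖Tᴴ‖) := by gcongr; exact norm_add_le _ _
      _ = ‖T‖ := by rw [l2_opNorm_conjTranspose]; ring
  have h1n : ‖(1 : Matrix (Finset (Orb Λ)) (Finset (Orb Λ)) ℂ)‖ ≤ 1 :=
    (norm_one (α := Matrix (Finset (Orb Λ)) (Finset (Orb Λ)) ℂ)).le
  have key := norm_trace_mul_exp_le_of_hermitianPart_le (A := (1 : Matrix (Finset (Orb Λ)) (Finset (Orb Λ)) ℂ))
    hHh zero_le_one hDn h1n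
  rw [one_mul, Complex.ofReal_one, ← hexp, one_mul] at key
  refine key.trans (le_of_eq ?_)
  congr 1
  rw [hHeq, neg_smul, one_smul, show -(onSiteSum ((β * U).re : ℂ) ((β * μ).re : ℂ) A) =
    -((1 : ℂ) • onSiteSum ((β * U).re : ℂ) ((β * μ).re : ℂ) A) by rw [one_smul], trace_exp_neg_onSiteSum]
  have hz : atomicPartitionFn (1 : ℂ) ((β * U).re : ℂ) ((β * μ).re : ℂ) =
      (atomicPartitionFnReal 1 (β * U).re (β * μ).re : ℂ) := by
    rw [← Complex.ofReal_one, atomicPartitionFn_ofReal]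
  rw [hz]
  norm_cast

/-! ### The site ratio and the bound on the normalised Gibbs factor -/

/-- **The site ratio** `r(β, U, μ) = z₀(1, Re βU, Re βμ) / |z₀(β, U, μ)|`: the price per site of
complex parameters in the trace bound (`= 1` for real parameters, `siteRatio_ofReal`).
[cite: Ueltschi1999, §2.3 (the factor e^{βf₀|𝒜|} ‖e^{-βV}‖^{|𝒜|} in the bound on ρ(𝒜))] -/
def siteRatio (β U μ : ℂ) : ℝ := atomicPartitionFnReal 1 (β * U).re (β * μ).re / ‖atomicPartitionFn β U μ‖

/-- The site ratio is nonnegative. [folklore] -/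
theorem siteRatio_nonneg (β U μ : ℂ) : 0 ≤ siteRatio β U μ :=
  div_nonneg (atomicPartitionFnReal_pos _ _ _).le (norm_nonneg _)

/-- At real parameters the site ratio is `1`. [folklore] -/
theorem siteRatio_ofReal (β U μ : ℝ) : siteRatio (β : ℂ) (U : ℂ) (μ : ℂ) = 1 := by
  unfold siteRatio
  rw [atomicPartitionFn_ofReal, Complex.norm_real, Real.norm_eq_abs, abs_of_pos (atomicPartitionFnReal_pos β U μ)]
  have h : atomicPartitionFnReal 1 ((β : ℂ) * (U : ℂ)).re ((β : ℂ) * (μ : ℂ)).re = atomicPartitionFnReal β U μ := by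
    rw [← Complex.ofReal_mul, ← Complex.ofReal_mul, Complex.ofReal_re, Complex.ofReal_re]
    unfold atomicPartitionFnReal
    ring_nf
  rw [h, div_self (atomicPartitionFnReal_pos β U μ).ne']

variable {β U μ : ℂ}

/-- **Two-fold factorisation**: for couplings supported on bonds inside `A`,
`Zc(c) · 2^{|Orb Λ|} = Tr exp(-βV_A + Σ c_b T_b) · Tr exp(-βV_{Aᶜ})`. [cite: Ueltschi1999, §2.1 (factorization property)] -/
theorem Zc_mul_two_pow (β U μ : ℂ) {A : Finset Λ} {c : Bond Λ → ℂ} (hc : ∀ b, c b ≠ 0 → b.1 ∈ A ∧ b.2.1 ∈ A) :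
    Zc β U μ c * 2 ^ Fintype.card (Orb Λ) =
      (NormedSpace.exp (-(β • onSiteSum U μ A) + hopSum c)).trace *
        (NormedSpace.exp (-(β • onSiteSum U μ Aᶜ))).trace := by
  have hV : onSiteSum U μ (Finset.univ : Finset Λ) = onSiteSum U μ A + onSiteSum U μ Aᶜ := by
    rw [← Finset.union_compl A, onSiteSum_union U μ disjoint_compl_right]
  have hexp : -(β • onSiteSum U μ (Finset.univ : Finset Λ)) + hopSum c =
      (-(β • onSiteSum U μ A) + hopSum c) + -(β • onSiteSum U μ Aᶜ) := by
    rw [hV, smul_add, neg_add]; abel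
  have m1 : -(β • onSiteSum U μ A) + hopSum c ∈ carEvenSubalgebra (orbs A) :=
    Subalgebra.add_mem _ (Subalgebra.neg_mem _ (Subalgebra.smul_mem _ (onSiteSum_mem U μ subset_rfl) _)) (hopSum_mem hc)
  have m3 : -(β • onSiteSum U μ Aᶜ) ∈ carEvenSubalgebra (orbs Aᶜ) :=
    Subalgebra.neg_mem _ (Subalgebra.smul_mem _ (onSiteSum_mem U μ subset_rfl) _)
  have hd : Disjoint (orbs A) (orbs Aᶜ) := disjoint_orbs disjoint_compl_right
  have hcomm := commute_of_mem_carEvenSubalgebra m1 (carEvenSubalgebra_le_carSubalgebra _ m3) hd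
  rw [Zc, hexp, Matrix.exp_add_of_commute _ _ hcomm]
  exact trace_mul_of_mem_carSubalgebra (exp_mem_subalgebra _ (carEvenSubalgebra_le_carSubalgebra _ m1))
    (exp_mem_subalgebra _ (carEvenSubalgebra_le_carSubalgebra _ m3)) hd

/-- **The normalised Gibbs factor is a ratio of local traces**:
`g(c) = Tr exp(-βV_A + Σ c T) / Tr exp(-βV_A)` for `c` supported inside `A` (`z₀ ≠ 0`).
[cite: Ueltschi1999, §2.3 (ρ(𝒜) only involves the sites of 𝒜)] -/
theorem gibbsRatio_eq_div (hz : atomicPartitionFn β U μ ≠ 0) {A : Finset Λ} {c : Bond Λ → ℂ}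
    (hc : ∀ b, c b ≠ 0 → b.1 ∈ A ∧ b.2.1 ∈ A) :
    gibbsRatio β U μ c = (NormedSpace.exp (-(β • onSiteSum U μ A) + hopSum c)).trace /
      (NormedSpace.exp (-(β • onSiteSum U μ A))).trace := by
  have h1 := Zc_mul_two_pow β U μ hc
  have h0 := Zc_mul_two_pow β U μ (A := A) (c := 0) (fun b hb => absurd rfl hb)
  rw [hopSum_zero, add_zero] at h0
  have hN : (2 : ℂ) ^ Fintype.card (Orb Λ) ≠ 0 := pow_ne_zero _ two_ne_zero
  have hτ₃ : (NormedSpace.exp (-(β • onSiteSum U μ Aᶜ))).trace ≠ 0 := by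
    rw [trace_exp_neg_onSiteSum]
    exact mul_ne_zero (pow_ne_zero _ hz) (pow_ne_zero _ (by norm_num))
  have hA : (NormedSpace.exp (-(β • onSiteSum U μ A))).trace ≠ 0 := by
    rw [trace_exp_neg_onSiteSum]
    exact mul_ne_zero (pow_ne_zero _ hz) (pow_ne_zero _ (by norm_num))
  have hZ0 : Zc β U μ (0 : Bond Λ → ℂ) ≠ 0 := Zc_zero_ne_zero hz
  unfold gibbsRatio
  rw [div_eq_div_iff hZ0 hA]
  apply mul_right_cancel₀ (mul_ne_zero hN hτ₃)
  calc Zc β U μ c * (NormedSpace.exp (-(β • onSiteSum U μ A))).trace * (2 ^ Fintype.card (Orb Λ) *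
        (NormedSpace.exp (-(β • onSiteSum U μ Aᶜ))).trace)
      = (Zc β U μ c * 2 ^ Fintype.card (Orb Λ)) * ((NormedSpace.exp (-(β • onSiteSum U μ A))).trace *
          (NormedSpace.exp (-(β • onSiteSum U μ Aᶜ))).trace) := by ring
    _ = ((NormedSpace.exp (-(β • onSiteSum U μ A) + hopSum c)).trace *
          (NormedSpace.exp (-(β • onSiteSum U μ Aᶜ))).trace) * (Zc β U μ 0 * 2 ^ Fintype.card (Orb Λ)) := by
        rw [h1, h0]
    _ = (NormedSpace.exp (-(β • onSiteSum U μ A) + hopSum c)).trace * Zc β U μ 0 *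
          (2 ^ Fintype.card (Orb Λ) * (NormedSpace.exp (-(β • onSiteSum U μ Aᶜ))).trace) := by ring

/-- **Bound on the normalised Gibbs factor**: for couplings supported inside `A`,
`|g(c)| ≤ e^{‖Σ c_b T_b‖} · r^{|A|}`. [cite: Ueltschi1999, §2.3 (bound on the matrix elements of ρ(𝒜))] -/
theorem norm_gibbsRatio_le (hz : atomicPartitionFn β U μ ≠ 0) {A : Finset Λ} {c : Bond Λ → ℂ}
    (hc : ∀ b, c b ≠ 0 → b.1 ∈ A ∧ b.2.1 ∈ A) :
    ‖gibbsRatio β U μ c‖ ≤ Real.exp ‖hopSum c‖ * siteRatio β U μ ^ A.card := by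
  rw [gibbsRatio_eq_div hz hc, norm_div, trace_exp_neg_onSiteSum, norm_mul, norm_pow, norm_pow]
  have h4 : ‖(4 : ℂ)‖ = 4 := by norm_num
  rw [h4]
  have hz' : 0 < ‖atomicPartitionFn β U μ‖ := norm_pos_iff.2 hz
  have hden : 0 < ‖atomicPartitionFn β U μ‖ ^ A.card * (4 : ℝ) ^ (Fintype.card Λ - A.card) := by positivity
  rw [div_le_iff₀ hden, siteRatio, div_pow]
  calc ‖(NormedSpace.exp (-(β • onSiteSum U μ A) + hopSum c)).trace‖
      ≤ Real.exp ‖hopSum c‖ * (atomicPartitionFnReal 1 (β * U).re (β * μ).re ^ A.card * 4 ^ (Fintype.card Λ - A.card)) :=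
        norm_trace_exp_le β U μ A (hopSum c)
    _ = Real.exp ‖hopSum c‖ * (atomicPartitionFnReal 1 (β * U).re (β * μ).re ^ A.card / ‖atomicPartitionFn β U μ‖ ^ A.card) *
          (‖atomicPartitionFn β U μ‖ ^ A.card * 4 ^ (Fintype.card Λ - A.card)) := by
        field_simp

/-! ### The bound on the bond weights -/

/-- The normalised Gibbs factor is an entire function of the couplings. [folklore] -/
theorem differentiable_gibbsRatio (β U μ : ℂ) : Differentiable ℂ (gibbsRatio (Λ := Λ) β U μ) := by
  unfold gibbsRatio Zc
  have hlin : Differentiable ℂ (fun c : Bond Λ → ℂ => hopSum c) := by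
    unfold hopSum
    fun_prop
  have hexp : Differentiable ℂ (fun X : Matrix (Finset (Orb Λ)) (Finset (Orb Λ)) ℂ => NormedSpace.exp X) :=
    fun X => (NormedSpace.exp_analytic (𝕂 := ℂ) X).differentiableAt
  have htr : Differentiable ℂ (fun X : Matrix (Finset (Orb Λ)) (Finset (Orb Λ)) ℂ => X.trace) :=
    (Matrix.traceLinearMap (Finset (Orb Λ)) ℂ ℂ).toContinuousLinearMap.differentiable
  have h2 : Differentiable ℂ (fun c : Bond Λ → ℂ =>
      NormedSpace.exp (-(β • onSiteSum U μ (Finset.univ : Finset Λ)) + hopSum c)) :=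
    hexp.comp ((differentiable_const _).add hlin)
  have h3 : Differentiable ℂ (fun c : Bond Λ → ℂ =>
      (NormedSpace.exp (-(β • onSiteSum U μ (Finset.univ : Finset Λ)) + hopSum c)).trace) := htr.comp h2
  simp_rw [div_eq_mul_inv]
  exact h3.mul_const _

/-- **Smallness per bond**: `|M(K)| ≤ (e² |τ|)^{|K|} · r^{|supp K|}` for `|τ| ≤ 1` (Cauchy bound
for the iterated difference with radius `1`; on the polydisc the couplings are supported in `K`
and bounded by `|τ| + 1 ≤ 2`, so `‖Σ c T‖ ≤ 2|K|`). [cite: Ueltschi1999, §2.3 and §3 (|ρ(𝒜)| ≤ e^{-c|𝒜|} when 2χ e^{c+1} βt ≤ 1)] -/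
theorem norm_bondWeight_le (hz : atomicPartitionFn β U μ ≠ 0) {τ : ℂ} (hτ : ‖τ‖ ≤ 1) (K : Finset (Bond Λ)) :
    ‖bondWeight β U μ τ K‖ ≤
      (Real.exp 2 * ‖τ‖) ^ K.card * siteRatio β U μ ^ (cellSupp Bond.verts K).card := by
  have hB : ∀ c' : Bond Λ → ℂ, (∀ b, ‖c' b‖ ≤ ‖τ‖ + 1) → (∀ b ∉ K, c' b = 0) →
      ‖gibbsRatio β U μ c'‖ ≤ Real.exp (2 * K.card) * siteRatio β U μ ^ (cellSupp Bond.verts K).card := by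
    intro c' hc' hK
    have hsupp : ∀ b, c' b ≠ 0 → b.1 ∈ cellSupp Bond.verts K ∧ b.2.1 ∈ cellSupp Bond.verts K := by
      intro b hb
      have hbK : b ∈ K := by by_contra h; exact hb (hK b h)
      exact endpoints_mem_cellSupp hbK
    refine (norm_gibbsRatio_le hz hsupp).trans (mul_le_mul_of_nonneg_right ?_ (pow_nonneg (siteRatio_nonneg _ _ _) _))
    rw [Real.exp_le_exp]
    refine (norm_hopSum_le_mul_card (s := 2) (fun b => (hc' b).trans (by linarith)) hK).trans (le_of_eq ?_)
    ring
  have h := norm_iterDiff_zero_le (differentiable_gibbsRatio β U μ) one_pos K hB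
  rw [bondWeight]
  refine h.trans (le_of_eq ?_)
  rw [div_one, mul_pow, ← Real.exp_nat_mul, mul_comm (K.card : ℝ) 2]
  ring

/-! ### Counting: bonds at a site, bonds touching a bond -/

section Counting

variable {G : SimpleGraph Λ} [DecidableRel G.Adj] {Δ : ℕ}

/-- On a graph of maximal degree `Δ`, at most `2Δ` bonds of `G` start at a given site and at most
`2Δ` end there. [folklore] -/
theorem card_hubbardBonds_fst_le (hΔ : ∀ v : Λ, (Finset.univ.filter (G.Adj v)).card ≤ Δ) (v : Λ) :
    ((hubbardBonds G).filter fun b => b.1 = v).card ≤ 2 * Δ ∧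
      ((hubbardBonds G).filter fun b => b.2.1 = v).card ≤ 2 * Δ := by
  constructor
  · have hsub : (hubbardBonds G).filter (fun b => b.1 = v) ⊆
        ((Finset.univ.filter (G.Adj v)) ×ˢ (Finset.univ : Finset (Fin 2))).image fun p => (v, p.1, p.2) := by
      intro b hb
      obtain ⟨hbD, rfl⟩ := Finset.mem_filter.1 hb
      refine Finset.mem_image.2 ⟨(b.2.1, b.2.2), Finset.mem_product.2 ⟨Finset.mem_filter.2 ⟨Finset.mem_univ _, ?_⟩,
        Finset.mem_univ _⟩, rfl⟩
      exact (mem_hubbardBonds (G := G)).1 hbD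
    refine (Finset.card_le_card hsub).trans (Finset.card_image_le.trans ?_)
    rw [Finset.card_product, Finset.card_univ, Fintype.card_fin, mul_comm]
    exact Nat.mul_le_mul_left 2 (hΔ v)
  · have hsub : (hubbardBonds G).filter (fun b => b.2.1 = v) ⊆
        ((Finset.univ.filter (G.Adj v)) ×ˢ (Finset.univ : Finset (Fin 2))).image fun p => (p.1, v, p.2) := by
      intro b hb
      obtain ⟨hbD, hv⟩ := Finset.mem_filter.1 hb
      refine Finset.mem_image.2 ⟨(b.1, b.2.2), Finset.mem_product.2 ⟨Finset.mem_filter.2 ⟨Finset.mem_univ _, ?_⟩,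
        Finset.mem_univ _⟩, ?_⟩
      · have h := (mem_hubbardBonds (G := G)).1 hbD
        rw [hv] at h
        exact h.symm
      · rw [← hv]
    refine (Finset.card_le_card hsub).trans (Finset.card_image_le.trans ?_)
    rw [Finset.card_product, Finset.card_univ, Fintype.card_fin, mul_comm]
    exact Nat.mul_le_mul_left 2 (hΔ v)

/-- At most `4Δ` bonds of `G` contain a given site. [folklore] -/
theorem card_hubbardBonds_mem_verts_le (hΔ : ∀ v : Λ, (Finset.univ.filter (G.Adj v)).card ≤ Δ) (v : Λ) :
    ((hubbardBonds G).filter fun b => v ∈ Bond.verts b).card ≤ 4 * Δ := by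
  have hsub : (hubbardBonds G).filter (fun b => v ∈ Bond.verts b) ⊆
      (hubbardBonds G).filter (fun b => b.1 = v) ∪ (hubbardBonds G).filter (fun b => b.2.1 = v) := by
    intro b hb
    obtain ⟨hbD, hv⟩ := Finset.mem_filter.1 hb
    simp only [Bond.verts, Finset.mem_insert, Finset.mem_singleton] at hv
    rcases hv with h | h
    · exact Finset.mem_union_left _ (Finset.mem_filter.2 ⟨hbD, h.symm⟩)
    · exact Finset.mem_union_right _ (Finset.mem_filter.2 ⟨hbD, h.symm⟩)
  obtain ⟨h1, h2⟩ := card_hubbardBonds_fst_le hΔ v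
  calc ((hubbardBonds G).filter fun b => v ∈ Bond.verts b).card
      ≤ ((hubbardBonds G).filter (fun b => b.1 = v) ∪ (hubbardBonds G).filter (fun b => b.2.1 = v)).card :=
        Finset.card_le_card hsub
    _ ≤ ((hubbardBonds G).filter (fun b => b.1 = v)).card + ((hubbardBonds G).filter (fun b => b.2.1 = v)).card :=
        Finset.card_union_le _ _
    _ ≤ 2 * Δ + 2 * Δ := add_le_add h1 h2
    _ = 4 * Δ := by ring

/-- At most `8Δ` bonds of `G` share a site with a given bond. [folklore] -/
theorem card_hubbardBonds_shareVertex_le (hΔ : ∀ v : Λ, (Finset.univ.filter (G.Adj v)).card ≤ Δ) (b₀ : Bond Λ) :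
    ((hubbardBonds G).filter fun b => ShareVertex Bond.verts b₀ b).card ≤ 8 * Δ := by
  have hsub : (hubbardBonds G).filter (fun b => ShareVertex Bond.verts b₀ b) ⊆
      (Bond.verts b₀).biUnion fun v => (hubbardBonds G).filter fun b => v ∈ Bond.verts b := by
    intro b hb
    obtain ⟨hbD, ⟨v, hv⟩⟩ := Finset.mem_filter.1 hb
    obtain ⟨hv₀, hvb⟩ := Finset.mem_inter.1 hv
    exact Finset.mem_biUnion.2 ⟨v, hv₀, Finset.mem_filter.2 ⟨hbD, hvb⟩⟩
  have hcard₀ : (Bond.verts b₀).card ≤ 2 := Finset.card_insert_le _ _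
  calc ((hubbardBonds G).filter fun b => ShareVertex Bond.verts b₀ b).card
      ≤ ((Bond.verts b₀).biUnion fun v => (hubbardBonds G).filter fun b => v ∈ Bond.verts b).card :=
        Finset.card_le_card hsub
    _ ≤ ∑ v ∈ Bond.verts b₀, ((hubbardBonds G).filter fun b => v ∈ Bond.verts b).card := Finset.card_biUnion_le
    _ ≤ ∑ _v ∈ Bond.verts b₀, 4 * Δ := Finset.sum_le_sum fun v _ => card_hubbardBonds_mem_verts_le hΔ v
    _ = (Bond.verts b₀).card * (4 * Δ) := by rw [Finset.sum_const, smul_eq_mul]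
    _ ≤ 2 * (4 * Δ) := Nat.mul_le_mul_right _ hcard₀
    _ = 8 * Δ := by ring

omit [Fintype Λ] in
/-- The support of a bond set has at most twice as many sites as there are bonds. [folklore] -/
theorem card_cellSupp_le (K : Finset (Bond Λ)) : (cellSupp Bond.verts K).card ≤ 2 * K.card := by
  calc (cellSupp Bond.verts K).card ≤ ∑ b ∈ K, (Bond.verts b).card := Finset.card_biUnion_le
    _ ≤ ∑ _b ∈ K, 2 := Finset.sum_le_sum fun b _ => Finset.card_insert_le _ _
    _ = 2 * K.card := by rw [Finset.sum_const, smul_eq_mul, mul_comm]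

end Counting

/-! ### The Kotecký–Preiss smallness of the site activity -/

section Smallness

variable {G : SimpleGraph Λ} [DecidableRel G.Adj] {Δ : ℕ}

/-- **Entropy of connected bond sets through a bond**: for `λ ≥ 0` with `(8Δ+1)² λ ≤ 1/2`,
`Σ_{X ⊆ bonds G connected, X ∋ b₀} λ^{|X|} ≤ 2λ` (the tree's lattice-animal bound
`sum_pow_card_le_of_connected` on the bond graph "share a site", whose degrees are `≤ 8Δ`).
[cite: Ueltschi1999, §2.3 (the constant ℶ: #{A ∋ x connected, |A| = k} ≤ ℶ^k)] -/
theorem sum_pow_card_connectedCellSets_le (hΔ : ∀ v : Λ, (Finset.univ.filter (G.Adj v)).card ≤ Δ) {lam : ℝ}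
    (hlam : 0 ≤ lam) (hsmall : ((8 * Δ : ℕ) + 1 : ℝ) ^ 2 * lam ≤ 1 / 2) (b₀ : Bond Λ) :
    ∑ X ∈ (connectedCellSets Bond.verts (hubbardBonds G)).filter (fun X => b₀ ∈ X), lam ^ X.card ≤ 2 * lam := by
  classical
  set D := hubbardBonds G with hD
  -- the bond graph restricted to `D`
  set R : Bond Λ → Bond Λ → Prop := fun b b' => ShareVertex Bond.verts b b' ∧ b ∈ D ∧ b' ∈ D with hR
  have hRs : ∀ b b', R b b' → R b' b := fun b b' ⟨h, hb, hb'⟩ => ⟨shareVertex_symm _ _ h, hb', hb⟩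
  set nbr : Bond Λ → Finset (Bond Λ) := fun b => D.filter fun b' => ShareVertex Bond.verts b b' with hnbr
  have hΔ' : ∀ b, (nbr b).card ≤ 8 * Δ := fun b => card_hubbardBonds_shareVertex_le hΔ b
  have hnbr' : ∀ b b', R b b' → b' ∈ nbr b := fun b b' ⟨h, _, hb'⟩ => Finset.mem_filter.2 ⟨hb', h⟩
  have hsmall' : (((8 * Δ : ℕ) : ℝ) + 1) ^ 2 * lam ≤ 1 / 2 := by exact_mod_cast hsmall
  refine sum_pow_card_le_of_connected (R := R) (nbr := nbr) (Δ := 8 * Δ) hRs hΔ' hnbr' hlam hsmall' b₀ _ ?_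
  intro X hX
  obtain ⟨hX, hb₀⟩ := Finset.mem_filter.1 hX
  obtain ⟨hXD, hXc⟩ := mem_connectedCellSets.1 hX
  obtain ⟨hne, hconn⟩ := hXc
  refine ⟨hb₀, hne, fun v hv w hw => ?_⟩
  exact Relation.ReflTransGen.mono (fun a b (h : ShareVertex Bond.verts a b ∧ a ∈ X ∧ b ∈ X) =>
    (⟨⟨h.1, hXD h.2.1, hXD h.2.2⟩, h.2.1, h.2.2⟩ : R a b ∧ a ∈ X ∧ b ∈ X)) _ _ (hconn v hv w hw)

/-- **One-site Kotecký–Preiss smallness of the Hubbard site activity** (finite volume, graph of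
maximal degree `Δ`): with `λ = e⁶ r₀² |τ|`, if `r ≤ r₀`, `1 ≤ r₀`, `|τ| ≤ 1` and
`(8Δ+1)² λ ≤ 1/2`, then for every site `x` and every finite family `𝒜` of site sets containing
`x`, `Σ_{A ∈ 𝒜} |siteActivity A| e^{2|A|} ≤ 8Δλ`. [cite: Ueltschi1999, §3 (|ρ(𝒜)| ≤ e^{-c|𝒜|} if 2χ e^{c+1} βt ≤ 1; the required inequality then holds with the constant ℶ)] -/
theorem sum_norm_siteActivity_mul_exp_le (hΔ : ∀ v : Λ, (Finset.univ.filter (G.Adj v)).card ≤ Δ)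
    (hz : atomicPartitionFn β U μ ≠ 0) {r₀ : ℝ} (hr₀ : 1 ≤ r₀) (hr : siteRatio β U μ ≤ r₀)
    {τ : ℂ} (hτ : ‖τ‖ ≤ 1) (hsmall : ((8 * Δ : ℕ) + 1 : ℝ) ^ 2 * (Real.exp 6 * r₀ ^ 2 * ‖τ‖) ≤ 1 / 2)
    (x : Λ) (𝒜 : Finset (Finset Λ)) (h𝒜 : ∀ A ∈ 𝒜, x ∈ A) :
    ∑ A ∈ 𝒜, ‖siteActivity G β U μ τ A‖ * Real.exp (2 * A.card) ≤ 8 * Δ * (Real.exp 6 * r₀ ^ 2 * ‖τ‖) := by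
  classical
  set lam : ℝ := Real.exp 6 * r₀ ^ 2 * ‖τ‖ with hlam
  have hlam0 : 0 ≤ lam := by positivity
  set D := hubbardBonds G with hD
  set CC := connectedCellSets Bond.verts D with hCC
  set f : Finset (Bond Λ) → ℝ := fun X => ‖bondWeight β U μ τ X‖ * Real.exp (2 * (cellSupp Bond.verts X).card) with hf
  have hf0 : ∀ X, 0 ≤ f X := fun X => by positivity
  -- Step a: bound by a sum over connected bond sets through `x`
  set Sx := CC.filter fun X => x ∈ cellSupp Bond.verts X with hSx
  have stepA : ∑ A ∈ 𝒜, ‖siteActivity G β U μ τ A‖ * Real.exp (2 * A.card) ≤ ∑ X ∈ Sx, f X := by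
    have h1 : ∀ A ∈ 𝒜, ‖siteActivity G β U μ τ A‖ * Real.exp (2 * A.card) ≤
        ∑ X ∈ CC.filter (fun X => cellSupp Bond.verts X = A), f X := by
      intro A _
      rw [siteActivity_apply, ← hD, ← hCC]
      refine (mul_le_mul_of_nonneg_right (norm_sum_le _ _) (Real.exp_nonneg _)).trans ?_
      rw [Finset.sum_mul]
      refine Finset.sum_le_sum fun X hX => le_of_eq ?_
      simp only [hf]
      rw [(Finset.mem_filter.1 hX).2]
    refine (Finset.sum_le_sum h1).trans ?_
    rw [← Finset.sum_biUnion]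
    · refine Finset.sum_le_sum_of_subset_of_nonneg ?_ fun X _ _ => hf0 X
      intro X hX
      obtain ⟨A, hA, hXA⟩ := Finset.mem_biUnion.1 hX
      obtain ⟨hXCC, hXsupp⟩ := Finset.mem_filter.1 hXA
      exact Finset.mem_filter.2 ⟨hXCC, hXsupp ▸ h𝒜 A hA⟩
    · intro A hA B hB hAB
      refine Finset.disjoint_left.2 fun X hXA hXB => hAB ?_
      rw [← (Finset.mem_filter.1 hXA).2, ← (Finset.mem_filter.1 hXB).2]
  -- Step b: each term is at most `λ^{|X|}`
  have stepB : ∀ X ∈ Sx, f X ≤ lam ^ X.card := by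
    intro X _
    have hb := norm_bondWeight_le hz hτ X
    have hs := card_cellSupp_le X
    set k := X.card
    set m := (cellSupp Bond.verts X).card
    have hr0 := siteRatio_nonneg β U μ
    calc f X ≤ (Real.exp 2 * ‖τ‖) ^ k * siteRatio β U μ ^ m * Real.exp (2 * m) :=
          mul_le_mul_of_nonneg_right hb (Real.exp_nonneg _)
      _ ≤ (Real.exp 2 * ‖τ‖) ^ k * r₀ ^ m * Real.exp (2 * m) := by
          gcongr
      _ = (Real.exp 2 * ‖τ‖) ^ k * (r₀ * Real.exp 2) ^ m := by
          rw [show (2 : ℝ) * m = (m : ℝ) * 2 by ring, Real.exp_nat_mul]; ring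
      _ ≤ (Real.exp 2 * ‖τ‖) ^ k * (r₀ * Real.exp 2) ^ (2 * k) := by
          refine mul_le_mul_of_nonneg_left (pow_le_pow_right₀ ?_ hs) (by positivity)
          have : (1 : ℝ) ≤ Real.exp 2 := Real.one_le_exp two_pos.le
          nlinarith
      _ = lam ^ k := by
          rw [hlam, pow_mul, ← mul_pow]
          congr 1
          have h6 : Real.exp 6 = Real.exp 2 ^ 3 := by
            rw [← Real.exp_nat_mul]; norm_num
          rw [h6]; ring
  -- Step c: cover `Sx` by the families through the bonds at `x`
  set Bx := D.filter fun b => x ∈ Bond.verts b with hBx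
  have hcover : Sx ⊆ Bx.biUnion fun b₀ => CC.filter fun X => b₀ ∈ X := by
    intro X hX
    obtain ⟨hXCC, hx⟩ := Finset.mem_filter.1 hX
    obtain ⟨b₀, hb₀X, hxb₀⟩ := mem_cellSupp.1 hx
    have hb₀D : b₀ ∈ D := (mem_connectedCellSets.1 hXCC).1 hb₀X
    exact Finset.mem_biUnion.2 ⟨b₀, Finset.mem_filter.2 ⟨hb₀D, hxb₀⟩, Finset.mem_filter.2 ⟨hXCC, hb₀X⟩⟩
  have stepC : ∑ X ∈ Sx, lam ^ X.card ≤ ∑ b₀ ∈ Bx, ∑ X ∈ CC.filter (fun X => b₀ ∈ X), lam ^ X.card :=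
    (Finset.sum_le_sum_of_subset_of_nonneg hcover fun X _ _ => pow_nonneg hlam0 _).trans
      (sum_biUnion_le_sum_of_nonneg Bx _ _ fun X => pow_nonneg hlam0 _)
  -- Step d/e: entropy bound and the number of bonds at `x`
  have stepD : ∀ b₀ ∈ Bx, ∑ X ∈ CC.filter (fun X => b₀ ∈ X), lam ^ X.card ≤ 2 * lam :=
    fun b₀ _ => sum_pow_card_connectedCellSets_le hΔ hlam0 hsmall b₀
  have stepE : (Bx.card : ℝ) ≤ 4 * Δ := by exact_mod_cast card_hubbardBonds_mem_verts_le hΔ x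
  calc ∑ A ∈ 𝒜, ‖siteActivity G β U μ τ A‖ * Real.exp (2 * A.card)
      ≤ ∑ X ∈ Sx, f X := stepA
    _ ≤ ∑ X ∈ Sx, lam ^ X.card := Finset.sum_le_sum stepB
    _ ≤ ∑ b₀ ∈ Bx, ∑ X ∈ CC.filter (fun X => b₀ ∈ X), lam ^ X.card := stepC
    _ ≤ ∑ _b₀ ∈ Bx, 2 * lam := Finset.sum_le_sum stepD
    _ = Bx.card * (2 * lam) := by rw [Finset.sum_const, nsmul_eq_mul]
    _ ≤ 4 * Δ * (2 * lam) := mul_le_mul_of_nonneg_right stepE (by positivity)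
    _ = 8 * Δ * lam := by ring

end Smallness

end Literature.MathematicalPhysics.QuantumLattice

end
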